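import Literature.Geometry.Lorentzian.TrappedSurface
import Literature.Geometry.Lorentzian.AsymptoticFlatness
import Literature.Geometry.Lorentzian.Volume
import HarnessLib

/-!
# Exterior regions, weakly outer trapped boundaries and the minimal enclosure area `A_min`
(the vocabulary of the Penrose heuristic over an asymptotically flat end, in a **light module**;
namespace `Literature.Geometry.Lorentzian`, all declarations in the structure namespace `AFEnd`)

Let `X` be a `3`-manifold (`ChartedSpace E3 X`), `e : AFEnd X` an asymptotically flat end
(`AsymptoticFlatness.lean`, open-end design: `e.far R'` is the far part `{R' < ‖x‖}` of the end),
`h` a smooth Riemannian metric on `TX` and `k` a symmetric `2`-tensor. This file houses the five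
notions through which a Penrose-type statement speaks of "the exterior region of the end", of "an
honest outermost MOTS bounding it" and of "the least area needed to enclose it":

* `AFEnd.IsExteriorRegion e U` — the open set `U` is *the exterior region of the end `e`*:
  connected, containing `e.far R'` for some `R' > e.R`, with `closure U ∖ e.far R'` compact
  (Huisken–Ilmanen, J. Differential Geom. 59 (2001), §0 "exterior region" and Lemma 4.1; Bray,
  J. Differential Geom. 59 (2001), §2);
* `AFEnd.IsWeaklyOuterTrappedFree h k e U` — `U` contains no compact embedded surface which
  bounds an open region `Ω` lying away from the end and is weakly outer trapped, `θ⁺ ≤ 0`, for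
  the normal pointing out of `Ω` (Andersson–Metzger, Comm. Math. Phys. 290 (2009), Defs. 7.1–7.2
  and Thm. 7.3: with `U = S.exterior` this says that `S` encloses the whole trapped region `T` of
  the end, i.e. `S = ∂⁺T`, the unique outermost MOTS; Mars, Class. Quantum Grav. 26 (2009)
  193001, §3, "weakly outer trapped boundaries", `𝒯⁺_Σ`);
* `AFEnd.IsOutsideOf e U f' ν'` — `U` is *the open region outside the closed surface `f'`
  towards `e`* (Bray 2001, §2 Def. 3, the class `𝒮`, encoded by the open outside region:
  `frontier U = range f'`, `ν'` points into `U`, `-ν'` out of `closure U`, and `U` is the exterior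
  region of `e`);
* `AFEnd.IsCalS h e V` — `V` is the outside region of *some* surface of `𝒮` (some compact
  smooth `2`-manifold `S'`, smooth embedding `f'`, `h`-unit normal `ν'` with `IsOutsideOf`);
* `AFEnd.minimalEnclosureArea h e U₀ : ℝ≥0∞` — **`A_min(Σ)` for `Σ = frontier U₀`** (Mars 2009,
  §3: *"any surface `S` that bounds an exterior domain always has a minimal area enclosure, i.e.
  the outermost of all surfaces which enclose `S` and have less or equal area than any other
  surface enclosing `S`. We will denote by `A_min(S)` the area of the minimal area enclosure of
  `S`"*, where *"`S₂` encloses `S₁` provided `Ω₁⁺ ⊇ Ω₂⁺`"*): the infimum of the Hausdorff areas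
  `area h (frontier V)` (`Volume.lean`) over the outside regions `V ⊆ U₀` of surfaces of `𝒮`,

with their elementary API (all proved): `AFEnd.IsExteriorRegion.nonempty/isConnected`,
`AFEnd.IsWeaklyOuterTrappedFree.not_isMaximalSlice` (for `k = 0` no minimal surface bounds a
region away from `e`), `AFEnd.IsOutsideOf.isExteriorRegion/frontier_eq/range_inter_eq_empty/isCalS`,
`AFEnd.IsCalS.isExteriorRegion`, `AFEnd.minimalEnclosureArea_le`,
`AFEnd.le_minimalEnclosureArea_iff`, `AFEnd.minimalEnclosureArea_anti`,
`AFEnd.minimalEnclosureArea_le_area_frontier`, `AFEnd.IsOutsideOf.minimalEnclosureArea_le_area_range`.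

## Why this file exists, and its relation to the originals (design)

Each of the five notions is a **verbatim copy** — same binders, same body — of a definition that
already lives higher up in the tree: `Literature.Geometry.Lorentzian.IsExteriorRegion` and
`IsWeaklyOuterTrappedFree` (`MassInequalities.lean`), `IsOutsideOf` (`MassCapacity.lean`),
`IsCalS` (`ConformalFlow.lean`) and `minimalEnclosureArea` with the five lemmas above
(`PenroseConjecture.lean`); the only textual change is that the copies refer to each other
(`e.IsExteriorRegion U` inside `AFEnd.IsOutsideOf`, `e.IsOutsideOf V f' ν'` inside `AFEnd.IsCalS`,
`e.IsCalS h V` inside `AFEnd.minimalEnclosureArea`), so that each copy is *definitionally equal*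
to its original (`Iff.rfl` / `rfl`; the identifications are recorded as theorems in
`EnclosureAreaBridge.lean`, which imports both ends). Those four files, however, are the homes of
the positive mass theorem, the Riemannian Penrose inequalities, Bray's mass–capacity theorems,
the weak inverse mean curvature flow and the conformal flow, vendored as **undischarged named
facts** (`positive_mass_theorem_riemannian`, `riemannian_penrose_inequality_smooth`,
`Bray2001_mass_ge_half_capacity`, `PenroseInequalityConjecture`, …): any statement that merely
*mentions* `A_min(S)` or an outermost MOTS bounding the exterior region of an end had to import
`PenroseConjecture.lean` and with it that whole cone of unproved facts, which the staffing rule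
for routes (no undischarged named fact in the import cone of a route statement) forbids. The
present module imports only the differential-geometric prelude — `TrappedSurface.lean`
(`IsWeaklyOuterTrapped`, `NormalField`, `curveThrough`, `OutermostMOTS`), `AsymptoticFlatness.lean`
(`AFEnd`) and `Volume.lean` (`area`) — and none of `MassInequalities` / `MassCapacity` /
`InverseMeanCurvatureFlow` / `ConformalFlow` / `PenroseConjecture`. The copies live in the
structure namespace `AFEnd` (dot notation: `e.IsExteriorRegion U`, `e.IsOutsideOf U f' ν'`,
`e.IsCalS h V`, `e.minimalEnclosureArea h U₀`, `e.IsWeaklyOuterTrappedFree h k U`) because one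
fully qualified name is declared in one module only; the originals stay where they are (they are
referenced by the ledger and by some twenty files) and may later be folded onto these copies by a
tree-wide maintenance change, which the definitional equalities make mechanical. Statements
filed over this module should use the `AFEnd.` names.

Design notes inherited from the originals (see the docstrings): connectedness in
`IsExteriorRegion` and the orientation datum `Ω` in `IsWeaklyOuterTrappedFree` are essential;
one-sided surfaces are not literally excluded by predicates quantifying over surfaces with a
global unit normal (harmless: thin two-sided tubes); *`A_min` is an infimum, not the area of a
minimiser* — the outermost minimal area enclosure exists and is unique (Bray 2001, §4 after
Def. 10; Mars 2009, §3, `n ≤ 8`) but is in general only `C^{1,1}` where it lifts off `Σ`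
(Huisken–Ilmanen 2001, §1, Thm. 1.3 (iii), (1.15)), so it need not be a surface of `𝒮`, while the
infimum over smooth enclosures needs neither existence nor regularity (it is `∞` only if no
surface of `𝒮` encloses `Σ`, never for `Σ ∈ 𝒮`; users of `toReal` should note the junk value `0`
there). Binders: `X : Type` (universe `0`, like `OutermostMOTS.surf` and the mass facts); `area`
needs `[LocallyCompactSpace X]` (automatic for manifolds) and `[MeasurableSpace X] [BorelSpace X]`
(users take `borel X`).

## Deliberately not here

`IsMinimalSurfaceFree` (`MassInequalities.lean`, Huisken–Ilmanen's condition (iii)); the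
conformal-area notions `conformalArea`, `IsOuterMinimizing`, `IsMinimalAreaEnclosure`, … of Bray's
flow (`ConformalFlow.lean`) and with them the identifications
`IsMinimalAreaEnclosure.minimalEnclosureArea_eq`, `IsOuterMinimizing.minimalEnclosureArea_eq`
(`PenroseConjecture.lean`); the trapped region `T` as a set and Andersson–Metzger's Thm. 7.3
(only the *predicate* "no weakly outer trapped set inside `U`" is needed to say `S = ∂⁺T`); and
every inequality — in particular the corrected Penrose conjecture `√(A_min(∂𝒯⁺_Σ)/16π) ≤ M_ADM`
(Mars 2009, §3), an open problem, is not declared here.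

## References

* G. Huisken, T. Ilmanen, *The inverse mean curvature flow and the Riemannian Penrose
  inequality*, J. Differential Geom. 59 (2001) 353–437: §0 (exterior region), §1 (weakly outer
  trapped = `H ≤ 0` for `k = 0`; minimizing hulls, Thm. 1.3 (iii), (1.15)), Lemma 4.1.
* H. L. Bray, *Proof of the Riemannian Penrose inequality using the positive mass theorem*,
  J. Differential Geom. 59 (2001) 177–267 (arXiv:math/9911173, same numbering): §2 Def. 3 (the
  class `𝒮`: *"the collection of surfaces which are smooth compact boundaries of open sets in `M³`
  containing the points `{∞_k}`"*, *"an inside (the open set) and an outside (the complement of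
  the open set)"*), Def. 6, §4 Def. 10 (*"the outermost minimal area enclosure of a smooth region
  is well-defined in that it always exists and is unique"*).
* L. Andersson, J. Metzger, *The area of horizons and the trapped region*, Comm. Math. Phys. 290
  (2009) 941–972 (arXiv:0708.4252, its numbering): §7, Def. 7.1 (weakly outer trapped set `Ω`:
  `θ⁺[∂⁺Ω] ≤ 0` *"with respect to the normal pointing out of `Ω`"*), Def. 7.2 (the trapped region
  `T`, the union of all weakly outer trapped sets), Thm. 7.3 (`∂⁺T` is a smooth stable MOTS).
* M. Mars, *Present status of the Penrose inequality*, Class. Quantum Grav. 26 (2009) 193001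
  (arXiv:0906.5566): §3 (weakly outer trapped boundaries, "encloses", `𝒯⁺_Σ`, minimal area
  enclosures and `A_min`, `M_ADM ≥ √(A_min(∂𝒯⁺_Σ)/16π)`).
* L. Andersson, M. Mars, W. Simon, Adv. Theor. Math. Phys. 12 (2008) 853–888: Def. 2.
-/

noncomputable section

open Bundle Set Manifold TopologicalSpace Filter MeasureTheory
open scoped ContDiff Topology ENNReal Manifold Real

namespace Literature.Geometry.Lorentzian

open PseudoRiemannianMetric

variable {X : Type} [TopologicalSpace X] [ChartedSpace E3 X]

/-! ### The exterior region of an end -/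

/-- *`U` is the exterior region of the end `e`* (Bray, J. Differential Geom. 59 (2001), §2,
"the region outside the outermost horizon"; Huisken–Ilmanen, J. Differential Geom. 59 (2001),
§0 and Lemma 4.1, "exterior region"; Mars, Class. Quantum Grav. 26 (2009) 193001, §3, "exterior
domain"): the open set `U` is *connected*, contains the far part `e.far R'` of the end for some
`R' > e.R`, and is compact modulo the end (`closure U \ e.far R'` is compact). Connectedness is
essential: without it an "exterior region" `S.exterior` of an `OutermostMOTS` could consist of
the true exterior plus a separate layer bounded by further minimal surfaces (a "bag of gold"
whose neck has large area), and the Penrose inequalities would be false. With it, every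
component of `S` borders the unbounded side and `U` has exactly the one end `e` (so no separate
`AFEnd.IsSoleEnd` hypothesis is needed and the part of `X` inside the horizon is unconstrained).
Verbatim copy, in the namespace `AFEnd` of a light module, of
`Literature.Geometry.Lorentzian.IsExteriorRegion` (`MassInequalities.lean`); the two agree by
`Iff.rfl`. [cite: HuiskenIlmanenIMCF2001, §0 exterior region and Lemma 4.1] -/
def AFEnd.IsExteriorRegion (e : AFEnd X) (U : Opens X) : Prop :=
  IsConnected (U : Set X) ∧
    ∃ R', e.R < R' ∧ e.far R' ⊆ (U : Set X) ∧ IsCompact (closure (U : Set X) \ e.far R')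

/-- An exterior region of an end is nonempty (it is connected, in particular nonempty; it
contains the far part of the end). Huisken–Ilmanen 2001, §0. [cite: HuiskenIlmanenIMCF2001, §0] -/
lemma AFEnd.IsExteriorRegion.nonempty {e : AFEnd X} {U : Opens X} (hU : e.IsExteriorRegion U) :
    (U : Set X).Nonempty :=
  hU.1.nonempty

/-- An exterior region of an end is connected (first clause of the definition).
Huisken–Ilmanen 2001, §0. [cite: HuiskenIlmanenIMCF2001, §0] -/
lemma AFEnd.IsExteriorRegion.isConnected {e : AFEnd X} {U : Opens X}
    (hU : e.IsExteriorRegion U) : IsConnected (U : Set X) :=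
  hU.1

/-- Unfolding of `AFEnd.IsExteriorRegion` (its two clauses). Huisken–Ilmanen 2001, §0.
[cite: HuiskenIlmanenIMCF2001, §0] -/
lemma AFEnd.isExteriorRegion_iff {e : AFEnd X} {U : Opens X} :
    e.IsExteriorRegion U ↔ IsConnected (U : Set X) ∧
      ∃ R', e.R < R' ∧ e.far R' ⊆ (U : Set X) ∧ IsCompact (closure (U : Set X) \ e.far R') :=
  Iff.rfl

/-! ### Regions free of weakly outer trapped boundaries -/

section Trapped

variable [IsManifold (𝓡 3) ∞ X]

/-- *`U` is free of surfaces weakly outer trapped towards the end `e`* in the data `(X, h, k)`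
(Andersson–Metzger, Comm. Math. Phys. 290 (2009), Def. 7.1 ("weakly outer trapped set": an
open `Ω` whose outer boundary `∂⁺Ω` is a smooth compact surface with `θ⁺[∂⁺Ω] ≤ 0` for the
normal pointing out of `Ω`), Def. 7.2 ("trapped region" `T` of an end, the union of all such
`Ω`) and Thm. 7.3 (`∂⁺T` is a smooth MOTS), arXiv:0708.4252 numbering; Mars, Class. Quantum
Grav. 26 (2009) 193001, §3 ("weakly outer trapped boundaries", `𝒯⁺_Σ`); Andersson–Mars–Simon,
ATMP 12 (2008), Def. 2): there is no nonempty compact smoothly embedded surface `f' : S' → X`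
with image in `U` which is the boundary `frontier Ω = range f'` of an open region `Ω ⊆ X` lying
*away from the end* `e` (`Ω` is disjoint from `e.far R'` for some `R' > e.R`; `Ω` need not be
precompact — it may hide further ends behind a neck), whose unit normal `ν'` points *out of*
`Ω`, i.e. towards the end (the chart-straight curve through `f' y` with velocity `ν' y` lies in
`Ω` for small `t < 0`, the pattern of `OutermostMOTS.pointsInto`), and which is weakly outer
trapped, `θ⁺ = tr_{S'} k + H ≤ 0` (`IsWeaklyOuterTrapped h k`). The orientation datum `Ω` is
essential for `k ≠ 0` (with the inward normal every small round sphere has `θ⁺ < 0`), and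
`Ω = X \ range f'` is excluded by the disjointness from the end. If `S` is the boundary `∂⁺T`
of the trapped region `T` of the end `e`, then `U = S.exterior` satisfies this; conversely this
is how a statement says "`S` is *the* outermost MOTS `∂𝒯⁺_Σ`" without constructing `T`.
Verbatim copy, in the namespace `AFEnd` of a light module, of
`Literature.Geometry.Lorentzian.IsWeaklyOuterTrappedFree` (`MassInequalities.lean`); the two
agree by `Iff.rfl`.
[cite: AnderssonMetzgerTrapped2009, Defs. 7.1–7.2 and Thm. 7.3 (arXiv:0708.4252 numbering)] -/
def AFEnd.IsWeaklyOuterTrappedFree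
    (h : ContMDiffRiemannianMetric (𝓡 3) ∞ E3 (TangentSpace (𝓡 3) : X → Type _))
    [(PseudoRiemannianMetric.ofRiemannian h).HasLeviCivita]
    (k : Π x : X, TangentSpace (𝓡 3) x →L[ℝ] TangentSpace (𝓡 3) x →L[ℝ] ℝ) (e : AFEnd X)
    (U : Opens X) : Prop :=
  ∀ (S' : Type) [TopologicalSpace S'] [ChartedSpace (EuclideanSpace ℝ (Fin 2)) S']
    [IsManifold (𝓡 2) ∞ S'] [CompactSpace S'] [T2Space S'] (f' : S' → X)
    (ν' : NormalField (𝓡 3) f')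
    (hpb' : PseudoRiemannianMetric.contMDiff_pullbackBilin (𝓡 3) X (𝓡 2) S' ∞)
    (hf' : (PseudoRiemannianMetric.ofRiemannian h).IsSpacelikeImmersion (𝓡 2) f')
    (Ω : Opens X),
    Manifold.IsSmoothEmbedding (𝓡 2) (𝓡 3) ∞ f' → Set.range f' ⊆ (U : Set X) →
    (PseudoRiemannianMetric.ofRiemannian h).IsUnitNormal (𝓡 2) f' ν' 1 → Nonempty S' →
    frontier (Ω : Set X) = Set.range f' → (∃ R', e.R < R' ∧ Disjoint (e.far R') (Ω : Set X)) →
    (∀ y, ∀ᶠ t in 𝓝[<] (0 : ℝ), curveThrough (𝓡 3) (f' y) (ν' y) t ∈ (Ω : Set X)) →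
    ¬ IsWeaklyOuterTrapped h k f' hpb' hf' ν'

/-- A region of time-symmetric data free of surfaces weakly outer trapped towards `e` contains
no closed minimal surface bounding a region away from `e`: `AFEnd.IsWeaklyOuterTrappedFree`
specialises, for `k = 0`, to minimal boundaries (a minimal surface is a MOTS, hence weakly outer
trapped, for `k = 0`; Huisken–Ilmanen 2001, §1; Andersson–Mars–Simon 2008, Def. 2). Verbatim
copy of `Literature.Geometry.Lorentzian.IsWeaklyOuterTrappedFree.not_isMaximalSlice`.
[cite: HuiskenIlmanenIMCF2001, §1] -/
lemma AFEnd.IsWeaklyOuterTrappedFree.not_isMaximalSlice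
    {D : InitialDataSet (𝓡 3) X} [(PseudoRiemannianMetric.ofRiemannian D.h).HasLeviCivita]
    {e : AFEnd X} {U : Opens X}
    (hU : e.IsWeaklyOuterTrappedFree D.h D.k U) (hts : D.IsTimeSymmetric)
    (S' : Type) [TopologicalSpace S'] [ChartedSpace (EuclideanSpace ℝ (Fin 2)) S']
    [IsManifold (𝓡 2) ∞ S'] [CompactSpace S'] [T2Space S'] (f' : S' → X)
    (ν' : NormalField (𝓡 3) f')
    (hpb' : PseudoRiemannianMetric.contMDiff_pullbackBilin (𝓡 3) X (𝓡 2) S' ∞)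
    (hf' : (PseudoRiemannianMetric.ofRiemannian D.h).IsSpacelikeImmersion (𝓡 2) f')
    (Ω : Opens X) (hemb : Manifold.IsSmoothEmbedding (𝓡 2) (𝓡 3) ∞ f')
    (hU' : Set.range f' ⊆ (U : Set X))
    (hν : (PseudoRiemannianMetric.ofRiemannian D.h).IsUnitNormal (𝓡 2) f' ν' 1)
    (hne : Nonempty S') (hfr : frontier (Ω : Set X) = Set.range f')
    (hfar : ∃ R', e.R < R' ∧ Disjoint (e.far R') (Ω : Set X))
    (hout : ∀ y, ∀ᶠ t in 𝓝[<] (0 : ℝ), curveThrough (𝓡 3) (f' y) (ν' y) t ∈ (Ω : Set X)) :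
    ¬ (PseudoRiemannianMetric.ofRiemannian D.h).IsMaximalSlice f' hpb' hf' ν' := by
  have hk : D.k = 0 := funext hts
  intro hM
  refine hU S' f' ν' hpb' hf' Ω hemb hU' hν hne hfr hfar hout ?_
  rw [hk]
  exact ((isMOTSInData_zero_iff D.h f' hpb' hf' ν').2 hM).isWeaklyOuterTrapped

end Trapped

/-! ### The outside region of a closed surface (Bray's class `𝒮`) -/

/-- **`U` is the open region outside the closed surface `f'` towards the end `e`** (Bray,
J. Differential Geom. 59 (2001), §2 Def. 3, the class `𝒮` — *"the collection of surfaces which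
are smooth compact boundaries of open sets in `M³` containing the points `{∞_k}`"*, the other
ends being compactified; *"all of the surfaces in `𝒮` divide `M³` into two regions, an inside
(the open set) and an outside (the complement of the open set)"* — in the open-end design:
`Σ = range f'` is the boundary `∂G` of the open inside `G = (closure U)ᶜ` and `U` is the
interior of the outside `M ∖ G`, which has exactly the chosen end): `frontier U = range f'`; the
field `ν'` along `f'` (meant: the unit normal) points into `U` — the chart-straight curve
through `f' y` with velocity `ν' y` lies in `U` for small `t > 0` — and out of `closure U` for
small `t < 0` (so `U` lies on one side of each component of `Σ`); and `U` is the exterior region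
of the end `e` (`AFEnd.IsExteriorRegion`: connected, containing `e.far R'` for some `R' > e.R`,
with `closure U ∖ e.far R'` compact — "containing the points `∞_k`" for the inside). These are
Mars's surfaces *"bounding an exterior domain `Ω⁺` containing the asymptotically euclidean end,
the outer normal chosen to point inside this domain"* (Mars 2009, §3). Verbatim copy, in the
namespace `AFEnd` of a light module, of `Literature.Geometry.Lorentzian.IsOutsideOf`
(`MassCapacity.lean`), with `AFEnd.IsExteriorRegion` for `IsExteriorRegion`; the two agree by
`Iff.rfl`. [cite: BrayRPI2001, §2 Def. 3] -/
def AFEnd.IsOutsideOf (e : AFEnd X) (U : Opens X) {S' : Type*} (f' : S' → X)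
    (ν' : NormalField (𝓡 3) f') : Prop :=
  frontier (U : Set X) = range f' ∧
  (∀ y, ∀ᶠ t in 𝓝[>] (0 : ℝ), curveThrough (𝓡 3) (f' y) (ν' y) t ∈ (U : Set X)) ∧
  (∀ y, ∀ᶠ t in 𝓝[<] (0 : ℝ), curveThrough (𝓡 3) (f' y) (ν' y) t ∉ closure (U : Set X)) ∧
  e.IsExteriorRegion U

/-- The outside region of a surface in `𝒮` is the exterior region of the end (last clause).
Bray 2001, §2 Def. 3. [cite: BrayRPI2001, §2 Def. 3] -/
theorem AFEnd.IsOutsideOf.isExteriorRegion {e : AFEnd X} {U : Opens X} {S' : Type*}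
    {f' : S' → X} {ν' : NormalField (𝓡 3) f'} (hU : e.IsOutsideOf U f' ν') :
    e.IsExteriorRegion U :=
  hU.2.2.2

/-- The surface is the topological boundary of its outside region (first clause).
Bray 2001, §2 Def. 3. [cite: BrayRPI2001, §2 Def. 3] -/
theorem AFEnd.IsOutsideOf.frontier_eq {e : AFEnd X} {U : Opens X} {S' : Type*} {f' : S' → X}
    {ν' : NormalField (𝓡 3) f'} (hU : e.IsOutsideOf U f' ν') :
    frontier (U : Set X) = range f' :=
  hU.1

/-- The surface is disjoint from its (open) outside region. [folklore] -/
theorem AFEnd.IsOutsideOf.range_inter_eq_empty {e : AFEnd X} {U : Opens X} {S' : Type*}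
    {f' : S' → X} {ν' : NormalField (𝓡 3) f'} (hU : e.IsOutsideOf U f' ν') :
    range f' ∩ (U : Set X) = ∅ := by
  rw [← hU.frontier_eq, ← Set.disjoint_iff_inter_eq_empty]
  exact disjoint_frontier_iff_isOpen.mpr U.isOpen

/-! ### The class `𝒮` by outside regions, and the minimal enclosure area `A_min` -/

section CalS

variable [IsManifold (𝓡 3) ∞ X]
  (h : ContMDiffRiemannianMetric (𝓡 3) ∞ E3 (TangentSpace (𝓡 3) : X → Type _))

/-- **`V` is the outside region (towards the end `e`) of a surface of Bray's class `𝒮`** (Bray,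
J. Differential Geom. 59 (2001), §2 Def. 3), in the encoding by the open outside region
(`AFEnd.IsOutsideOf`): for **some** compact smooth `2`-manifold `S'`, smooth embedding
`f' : S' → X` and unit normal `ν'` along it (for `h`; only its direction matters),
`e.IsOutsideOf V f' ν'` holds — `frontier V = range f'`, `ν'` points into `V` and `-ν'` out of
`closure V`, and `V` is the exterior region of the end `e`. The empty surface is allowed
(`V = X` when `X` has just the end `e`). Verbatim copy, in the namespace `AFEnd` of a light
module, of `Literature.Geometry.Lorentzian.IsCalS` (`ConformalFlow.lean`), with
`AFEnd.IsOutsideOf` for `IsOutsideOf`; the two agree by `Iff.rfl`.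
[cite: BrayRPI2001, §2 Def. 3] -/
def AFEnd.IsCalS (e : AFEnd X) (V : Opens X) : Prop :=
  ∃ (S' : Type) (_ : TopologicalSpace S') (_ : ChartedSpace (EuclideanSpace ℝ (Fin 2)) S')
    (_ : IsManifold (𝓡 2) ∞ S') (_ : CompactSpace S') (_ : T2Space S')
    (f' : S' → X) (ν' : NormalField (𝓡 3) f'),
    Manifold.IsSmoothEmbedding (𝓡 2) (𝓡 3) ∞ f' ∧ (ofRiemannian h).IsUnitNormal (𝓡 2) f' ν' 1 ∧
      e.IsOutsideOf V f' ν'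

/-- The outside region of an embedded compact surface with unit normal (`AFEnd.IsOutsideOf`) is
the outside region of a surface of `𝒮`. Bray 2001, Def. 3. [cite: BrayRPI2001, §2 Def. 3] -/
theorem AFEnd.IsOutsideOf.isCalS {e : AFEnd X} {V : Opens X} {S' : Type}
    [t : TopologicalSpace S'] [c : ChartedSpace (EuclideanSpace ℝ (Fin 2)) S']
    [m : IsManifold (𝓡 2) ∞ S'] [k : CompactSpace S'] [t2 : T2Space S'] {f' : S' → X}
    {ν' : NormalField (𝓡 3) f'} (hV : e.IsOutsideOf V f' ν')
    (hf' : Manifold.IsSmoothEmbedding (𝓡 2) (𝓡 3) ∞ f')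
    (hν' : (ofRiemannian h).IsUnitNormal (𝓡 2) f' ν' 1) : e.IsCalS h V :=
  ⟨S', t, c, m, k, t2, f', ν', hf', hν', hV⟩

/-- The outside region of a surface of `𝒮` is the exterior region of the end. Bray 2001, Def. 3
("containing the points `∞_k`"). [cite: BrayRPI2001, §2 Def. 3] -/
theorem AFEnd.IsCalS.isExteriorRegion {e : AFEnd X} {V : Opens X} (hV : e.IsCalS h V) :
    e.IsExteriorRegion V := by
  obtain ⟨_, _, _, _, _, _, _, _, -, -, hout⟩ := hV
  exact hout.isExteriorRegion

variable [T2Space X] [LocallyCompactSpace X] [MeasurableSpace X] [BorelSpace X]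

/-- **The minimal enclosure area `A_min(Σ)` of the surface `Σ = frontier U₀` bounding the
exterior domain `U₀` of the end `e`** (Mars, Class. Quantum Grav. 26 (2009) 193001, §3: *"any
surface `S` that bounds an exterior domain always has a minimal area enclosure, i.e. the
outermost of all surfaces which enclose `S` and have less or equal area than any other surface
enclosing `S`. We will denote by `A_min(S)` the area of the minimal area enclosure of `S`"*, where
*"`S₂` encloses `S₁` provided `Ω₁⁺ ⊇ Ω₂⁺`"* for the exterior domains they bound; Bray 2001, §4
Def. 10), taken as the **infimum** of the areas `area h (frontier V)` (`2`-dimensional Hausdorff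
area of the length metric of `h`, `Volume.lean`) over all outside regions `V ⊆ U₀` of surfaces
of Bray's class `𝒮` (`e.IsCalS h V`), i.e. over the smooth boundaries of exterior domains
enclosing `Σ`. The infimum form needs neither the existence nor the (`C^{1,1}`) regularity of
the minimiser and agrees with the area of a minimal area enclosure in Bray's sense when `𝒮`
contains one (`IsMinimalAreaEnclosure.minimalEnclosureArea_eq`, `PenroseConjecture.lean`); it is
`∞` iff there is no competitor (never the case for `U₀` itself the outside region of a surface
of `𝒮`, `AFEnd.minimalEnclosureArea_le_area_frontier`). Verbatim copy, in the namespace `AFEnd`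
of a light module, of `Literature.Geometry.Lorentzian.minimalEnclosureArea`
(`PenroseConjecture.lean`), with `AFEnd.IsCalS` for `IsCalS`; the two agree by `rfl`.
[cite: Mars2009, §3 (minimal area enclosure, A_min)] -/
def AFEnd.minimalEnclosureArea (e : AFEnd X) (U₀ : Opens X) : ℝ≥0∞ :=
  ⨅ (V : Opens X) (_ : e.IsCalS h V ∧ V ≤ U₀), area h (frontier (V : Set X))

/-- Every smooth enclosing surface bounds `A_min` from above: if `frontier V ∈ 𝒮` encloses
`frontier U₀` (`V ⊆ U₀`) then `A_min(frontier U₀) ≤ |frontier V|`. Mars 2009, §3.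
[cite: Mars2009, §3 (minimal area enclosure, A_min)] -/
theorem AFEnd.minimalEnclosureArea_le {e : AFEnd X} {U₀ V : Opens X} (hV : e.IsCalS h V)
    (hle : V ≤ U₀) : e.minimalEnclosureArea h U₀ ≤ area h (frontier (V : Set X)) :=
  iInf₂_le V ⟨hV, hle⟩

/-- Characterisation of lower bounds of `A_min`: `a ≤ A_min(frontier U₀)` iff `a` is at most the
area of every smooth surface of `𝒮` enclosing `frontier U₀`. [folklore] -/
theorem AFEnd.le_minimalEnclosureArea_iff {e : AFEnd X} {U₀ : Opens X} {a : ℝ≥0∞} :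
    a ≤ e.minimalEnclosureArea h U₀ ↔
      ∀ V : Opens X, e.IsCalS h V → V ≤ U₀ → a ≤ area h (frontier (V : Set X)) := by
  simp only [AFEnd.minimalEnclosureArea, le_iInf_iff, and_imp]

/-- `A_min` is antitone in the exterior domain: a surface enclosing `frontier U₀` also encloses
the boundary of any larger exterior domain `U₁ ⊇ U₀`, so `A_min(frontier U₁) ≤ A_min(frontier U₀)`
(Mars 2009, §3: `A_min(∂𝒯⁺_Σ) ≥ A_min(S)` for every weakly outer trapped boundary `S`, which
`∂𝒯⁺_Σ` encloses). [cite: Mars2009, §3 (minimal area enclosure, A_min)] -/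
theorem AFEnd.minimalEnclosureArea_anti {e : AFEnd X} {U₀ U₁ : Opens X} (hU : U₀ ≤ U₁) :
    e.minimalEnclosureArea h U₁ ≤ e.minimalEnclosureArea h U₀ :=
  le_iInf₂ fun V hV ↦ iInf₂_le V ⟨hV.1, hV.2.trans hU⟩

/-- A surface of `𝒮` encloses itself, so `A_min(frontier U₀) ≤ |frontier U₀|` when `U₀` is the
outside region of a surface of `𝒮`. Mars 2009, §3.
[cite: Mars2009, §3 (minimal area enclosure, A_min)] -/
theorem AFEnd.minimalEnclosureArea_le_area_frontier {e : AFEnd X} {U₀ : Opens X}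
    (hU₀ : e.IsCalS h U₀) : e.minimalEnclosureArea h U₀ ≤ area h (frontier (U₀ : Set X)) :=
  AFEnd.minimalEnclosureArea_le h hU₀ le_rfl

/-- For a compact smoothly embedded surface `f'` with unit normal `ν'` whose outside region
towards `e` is `U` (`AFEnd.IsOutsideOf`), `A_min(range f') ≤ |range f'|` (Hausdorff area of the
image). Mars 2009, §3. [cite: Mars2009, §3 (minimal area enclosure, A_min)] -/
theorem AFEnd.IsOutsideOf.minimalEnclosureArea_le_area_range {e : AFEnd X} {U : Opens X}
    {S' : Type} [TopologicalSpace S'] [ChartedSpace (EuclideanSpace ℝ (Fin 2)) S']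
    [IsManifold (𝓡 2) ∞ S'] [CompactSpace S'] [T2Space S'] {f' : S' → X}
    {ν' : NormalField (𝓡 3) f'} (hU : e.IsOutsideOf U f' ν')
    (hf' : Manifold.IsSmoothEmbedding (𝓡 2) (𝓡 3) ∞ f')
    (hν' : (ofRiemannian h).IsUnitNormal (𝓡 2) f' ν' 1) :
    e.minimalEnclosureArea h U ≤ area h (range f') := by
  rw [← hU.frontier_eq]
  exact AFEnd.minimalEnclosureArea_le_area_frontier h (hU.isCalS h hf' hν')

end CalS

end Literature.Geometry.Lorentzian

end
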